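import Literature.Barriers.BirchSwinnertonDyer.PAdicFunctionalEquationIdealFormProofs
import Summits.BirchSwinnertonDyer.Rank1Residual.Iwasawa.LambdaInvariantZeros
import Summits.BirchSwinnertonDyer.Rank1Residual.X1.LambdaSqueezeAlgebra
import Summits.BirchSwinnertonDyer.BirchSwinnertonDyer.Theorems.SignedLowerHalvesSprungLowerDivisibilityAtThreeIotaDescent
import Mathlib.Algebra.Polynomial.Degree.SmallDegree
import HarnessLib

/-!
# The `ι`-symmetry law at `λ = 2` (bsd-rank2 [rank2-p2] GEN 67, part E — pure `Λ`-algebra)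

Cell `bsd-rank2`, seat p2, GEN 67.  PURE `Λ`-ALGEBRA (any prime `p`), no elliptic curve.  Greenberg's involution
`ι : T ↦ (1+T)⁻¹ − 1` of `Λ = ℤ_p⟦T⟧` fixes the ideal generated by (any integral lift of) a good-ordinary `p`-adic
`L`-function (`IwasawaAlgebra.span_singleton_subst_eq_of_eq_padicLFunction`, MTT §I.17 descended to `Λ`).  We read that
symmetry on an element of `λ`-invariant `2`: by the uniqueness half of Weierstrass preparation (Mathlib
`PowerSeries.IsWeierstrassFactorization.elim`) the distinguished polynomial `P = T² + aT + b` of `pfree g` must coincide with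
the renormalised distinguished polynomial of `(1+T)²·P(T^ι) = (1−a+b)T² + (2b−a)T + b`, which forces

  `b·(b − a) = 0` and `(a − b)·(2 − a) = 0`, i.e. **`P = T² + a·(T + 1)`  or  `P = T·(T + 2)`**

(the second family is empty for odd `p`, since `a ∈ pℤ_p`).  Readings: `T ∣ pfree g ⟺ b = 0`; the constant term of `pfree g` is
`b`·unit.  On the Matsuno class `𝒞(15A8)` at `p = 2` (GEN 63–67, where `λ = 2` class-wide) this is the structure behind the observed
pair law `P_A(0) + P_A(−2) = 4` of the exact Birch sums (kit job j341850): `w = −1 ⟹ P_A = T(T+2)`, `w = +1 ⟹ P_A = T² + a(T+1)`.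

Relation to the tree's `ι`-descent files (`…Theorems.ChromaticIotaDescent`, `…Theorems.ChromaticIota`, cell bsd-ssimc, Sprung pairs at
`p ≠ 2`): `ChromaticIotaDescent.twist_two` computes the `ι`-conjugate `f^ι` of a distinguished quadratic as an ideal; here we add the
SELF-DUAL CLASSIFICATION forced by the functional equation `(g(T^ι)) = (g)` at `λ(g) = 2` — including `p = 2`, where the second family
`T(T+2)` exists — and its instantiation to ordinary `L_p(E,T)` (any `p`) via `IwasawaAlgebra.span_singleton_subst_eq_of_eq_padicLFunction`.
We reuse `isDistinguishedAt_quadratic`, `isUnit_one_add_X`, `two_not_mem_maximalIdeal` from those files.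

* §1 `(1+T)²·(T² + aT + b)(T^ι) = T² − aT(1+T) + b(1+T)²` (`one_add_X_sq_mul_subst_quadratic`).
* §2 the coefficient law from `ι`-symmetry of `(T² + aT + b)·U` (`quadratic_iota_law`, Weierstrass uniqueness).
* §3 packaging with `μ, pfree, λ` of `X1.MuLambdaAlgebra`: `exists_normalForm_of_lam_eq_two` (+ odd `p`: always the first family).
* §4 readings of the normal form (`T ∣ h ⟺ b = 0`, `p^k ∣ h(0) ⟺ p^k ∣ b`, rigidity `eq_of_quadratic_dvd_normalForm`, `P(0)+P(−2) = 4`).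
* §5 ★ `normalForm_of_eq_padicLFunction` / `_odd`: every integral lift of a good-ordinary `L_p(E,T)` with `λ = 2`.
-/

-- planner-bsd-rank2-p2-g67-0 (cell bsd-rank2, seat p2, GEN 67, part E)

set_option autoImplicit false
set_option linter.dupNamespace false

noncomputable section

open scoped Classical

open PowerSeries Literature.NumberTheory.EllipticCurves Literature.NumberTheory.EllipticCurves.ModularForms
  Literature.Barriers.BirchSwinnertonDyer Summit.BirchSwinnertonDyer.Rank1Residual.X1.MuLambda
  Summit.BirchSwinnertonDyer.Rank1Residual.X1.ParitySqueeze Summit.BirchSwinnertonDyer.Rank1Residual.Iwasawa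
  Summit.BirchSwinnertonDyer.BirchSwinnertonDyer.Theorems.ChromaticIotaDescent

namespace Summit.BirchSwinnertonDyer.BirchSwinnertonDyer.Theorems.LambdaTransportDoorIotaSymmetryLambdaTwo

variable {p : ℕ} [Fact p.Prime]

/-! ## §1 Substituting `ι` into a quadratic -/

/-- `(C r)(T^ι) = C r`: substitution fixes constants (in `Λ = ℤ_p⟦T⟧`). [folklore] -/
theorem subst_invOnePlusSubOne_C_padicInt (r : ℤ_[p]) :
    (C r : ℤ_[p]⟦X⟧).subst (invOnePlusSubOne : ℤ_[p]⟦X⟧) = C r := by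
  have hι := hasSubst_invOnePlusSubOne (R := ℤ_[p])
  rw [← mul_one (C r), ← smul_eq_C_mul, subst_smul hι, ← coe_substAlgHom hι, map_one]

/-- **`(1+T)² · (T² + aT + b)(T^ι) = T² − aT(1+T) + b(1+T)²`**, from `(1+T)·T^ι = −T`
(`one_add_X_mul_invOnePlusSubOne_add_one`). [folklore] -/
theorem one_add_X_sq_mul_subst_quadratic (a b : ℤ_[p]) :
    (1 + X : ℤ_[p]⟦X⟧) ^ 2 * (X ^ 2 + C a * X + C b : ℤ_[p]⟦X⟧).subst (invOnePlusSubOne : ℤ_[p]⟦X⟧) =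
      X ^ 2 - C a * X * (1 + X) + C b * (1 + X) ^ 2 := by
  have hι := hasSubst_invOnePlusSubOne (R := ℤ_[p])
  have h := one_add_X_mul_invOnePlusSubOne_add_one (R := ℤ_[p])
  rw [subst_add hι, subst_add hι, subst_mul hι, subst_pow hι, subst_X hι, subst_invOnePlusSubOne_C_padicInt,
    subst_invOnePlusSubOne_C_padicInt]
  linear_combination ((1 + X) * ((invOnePlusSubOne : ℤ_[p]⟦X⟧) + 1) - 1 - 2 * X + C a * (1 + X)) * h

/-! ## §2 The coefficient law forced by `ι`-symmetry -/

/-- The quadratic `T² + aT + b` as a polynomial coerces to the power series `T² + aT + b`. [folklore] -/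
theorem coe_quadratic (a b : ℤ_[p]) :
    ((Polynomial.C 1 * Polynomial.X ^ 2 + Polynomial.C a * Polynomial.X + Polynomial.C b : Polynomial ℤ_[p]) :
      ℤ_[p]⟦X⟧) = X ^ 2 + C a * X + C b := by
  simp only [Polynomial.coe_add, Polynomial.coe_mul, Polynomial.coe_pow, Polynomial.coe_C, Polynomial.coe_X,
    map_one, one_mul]

/-- **The `ι`-symmetry coefficient law.**  If `a, b ∈ pℤ_p`, `U, v ∈ Λˣ` and the element `h = (T² + aT + b)·U`
satisfies `h(T^ι) = v·h`, then `b(b − a) = 0` and `(a − b)(2 − a) = 0`.  Proof: `(1+T)²h(T^ι) = Q̃·U(T^ι)` with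
`Q̃ = (1−a+b)T² + (2b−a)T + b` (§1), `1 − a + b ∈ ℤ_pˣ`; renormalising `Q̃` to a distinguished `Q` gives a second Weierstrass
factorisation of `(1+T)²·v·h`, so `Q = T² + aT + b` by uniqueness (Mathlib `IsWeierstrassFactorization.elim`), and comparing
the two low coefficients gives the law. [cite: Washington1997, Thm. 7.3 (uniqueness in Weierstrass preparation)]
[cite: GreenbergLNM1716, §1 (p. 68: `f(T^ι)/f(T) ∈ Λˣ`)] -/
theorem quadratic_iota_law {a b : ℤ_[p]} (ha : a ∈ IsLocalRing.maximalIdeal ℤ_[p])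
    (hb : b ∈ IsLocalRing.maximalIdeal ℤ_[p]) {U v : ℤ_[p]⟦X⟧} (hU : IsUnit U) (hv : IsUnit v)
    (hFE : ((X ^ 2 + C a * X + C b) * U : ℤ_[p]⟦X⟧).subst (invOnePlusSubOne : ℤ_[p]⟦X⟧) =
      v * ((X ^ 2 + C a * X + C b) * U)) :
    b * (b - a) = 0 ∧ (a - b) * (2 - a) = 0 := by
  have hι := hasSubst_invOnePlusSubOne (R := ℤ_[p])
  -- the renormalising unit `c = 1 − a + b`
  have hc : IsUnit (1 - (a - b)) :=
    IsLocalRing.isUnit_one_sub_self_of_mem_nonunits (a - b)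
      ((IsLocalRing.mem_maximalIdeal _).mp (sub_mem ha hb))
  obtain ⟨cu, hcu⟩ := hc
  set ci : ℤ_[p] := ↑cu⁻¹ with hci_def
  have hci : (1 - (a - b)) * ci = 1 := by rw [← hcu, hci_def, Units.mul_inv]
  -- the two distinguished polynomials
  set P : Polynomial ℤ_[p] := Polynomial.C 1 * Polynomial.X ^ 2 + Polynomial.C a * Polynomial.X + Polynomial.C b
    with hP
  set Q : Polynomial ℤ_[p] := Polynomial.C 1 * Polynomial.X ^ 2 + Polynomial.C (ci * (2 * b - a)) * Polynomial.X +
    Polynomial.C (ci * b) with hQ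
  have hPd : P.IsDistinguishedAt (IsLocalRing.maximalIdeal ℤ_[p]) := (isDistinguishedAt_quadratic ha hb).1
  have hQd : Q.IsDistinguishedAt (IsLocalRing.maximalIdeal ℤ_[p]) :=
    (isDistinguishedAt_quadratic (Ideal.mul_mem_left _ _ (sub_mem (Ideal.mul_mem_left _ _ hb) ha))
      (Ideal.mul_mem_left _ _ hb)).1
  have hPcoe : (P : ℤ_[p]⟦X⟧) = X ^ 2 + C a * X + C b := coe_quadratic a b
  have hCci : C (1 - (a - b)) * C ci = (1 : ℤ_[p]⟦X⟧) := by rw [← map_mul, hci, map_one]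
  have hCci' : (1 - (C a - C b)) * C ci = (1 : ℤ_[p]⟦X⟧) := by simpa only [map_sub, map_one] using hCci
  have hQcoe : C (1 - (a - b)) * (Q : ℤ_[p]⟦X⟧) = X ^ 2 - C a * X * (1 + X) + C b * (1 + X) ^ 2 := by
    rw [hQ, coe_quadratic]
    simp only [map_mul, map_sub, map_ofNat, map_one]
    linear_combination ((2 * C b - C a) * X + C b) * hCci'
  -- units
  have h1X : IsUnit (1 + X : ℤ_[p]⟦X⟧) := isUnit_one_add_X
  have hUι : IsUnit (U.subst (invOnePlusSubOne : ℤ_[p]⟦X⟧)) := by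
    rw [← coe_substAlgHom hι]; exact hU.map _
  have hCc : IsUnit (C (1 - (a - b)) : ℤ_[p]⟦X⟧) := by
    rw [← hcu]; exact cu.isUnit.map C
  -- the common element `g = Q̃ · U(T^ι) = P · ((1+T)² v U)`
  set g : ℤ_[p]⟦X⟧ := (X ^ 2 - C a * X * (1 + X) + C b * (1 + X) ^ 2) * U.subst (invOnePlusSubOne : ℤ_[p]⟦X⟧)
    with hg
  have hgP : g = (P : ℤ_[p]⟦X⟧) * ((1 + X) ^ 2 * v * U) := by
    rw [hg, hPcoe, ← one_add_X_sq_mul_subst_quadratic a b]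
    rw [subst_mul hι] at hFE
    linear_combination ((1 + X : ℤ_[p]⟦X⟧) ^ 2) * hFE
  have hgQ : g = (Q : ℤ_[p]⟦X⟧) * (C (1 - (a - b)) * U.subst (invOnePlusSubOne : ℤ_[p]⟦X⟧)) := by
    rw [hg, ← hQcoe]; ring
  have hWP : g.IsWeierstrassFactorization P ((1 + X) ^ 2 * v * U) :=
    ⟨hPd, ((h1X.pow 2).mul hv).mul hU, hgP⟩
  have hWQ : g.IsWeierstrassFactorization Q (C (1 - (a - b)) * U.subst (invOnePlusSubOne : ℤ_[p]⟦X⟧)) :=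
    ⟨hQd, hCc.mul hUι, hgQ⟩
  have hPQ : P = Q := (hWP.elim hWQ).1
  have h0 : b = ci * b := by
    have := congrArg (Polynomial.coeff · 0) hPQ
    simpa [hP, hQ] using this
  have h1 : a = ci * (2 * b - a) := by
    have := congrArg (Polynomial.coeff · 1) hPQ
    simpa [hP, hQ] using this
  constructor
  · linear_combination (1 - (a - b)) * h0 + b * hci
  · linear_combination (1 - (a - b)) * h1 + (2 * b - a) * hci

/-! ## §3 Normal form of an `ι`-symmetric element of `λ`-invariant `2` -/

/-- **Normal form at `λ = 2` under `ι`-symmetry (any prime `p`).**  If `g ∈ Λ ∖ {0}` has `λ(g) = 2` and `(g(T^ι)) = (g)`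
as ideals of `Λ` (e.g. `g` an integral lift of a good-ordinary `L_p(E,T)`:
`IwasawaAlgebra.span_singleton_subst_eq_of_eq_padicLFunction`), then `pfree g = (T² + aT + b)·U` with `U ∈ Λˣ`,
`a, b ∈ pℤ_p`, and **`a = b` or `(b = 0 ∧ a = 2)`**: the distinguished polynomial of `g` is `T² + a(T+1)` or `T(T+2)`.
[cite: Washington1997, Thm. 7.3] [cite: GreenbergLNM1716, §1 (p. 68)] [cite: MazurTateTeitelbaum1986Invent, §I.17] -/
theorem exists_normalForm_of_lam_eq_two {g : IwasawaAlgebra p} (hg : g ≠ 0) (hlam : lam g = 2)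
    (hsym : Ideal.span {g.subst (invOnePlusSubOne : ℤ_[p]⟦X⟧)} = Ideal.span {g}) :
    ∃ (a b : ℤ_[p]) (U : ℤ_[p]⟦X⟧), IsUnit U ∧ a ∈ IsLocalRing.maximalIdeal ℤ_[p] ∧
      b ∈ IsLocalRing.maximalIdeal ℤ_[p] ∧ pfree g = (X ^ 2 + C a * X + C b) * U ∧
      (a = b ∨ (b = 0 ∧ a = 2)) := by
  have hι := hasSubst_invOnePlusSubOne (R := ℤ_[p])
  have hred : (pfree g).map (IsLocalRing.residue ℤ_[p]) ≠ 0 := red_pfree_ne_zero hg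
  have hW := (pfree g).isWeierstrassFactorization_weierstrassDistinguished_weierstrassUnit hred
  set P := (pfree g).weierstrassDistinguished hred with hPdef
  set U := (pfree g).weierstrassUnit hred with hUdef
  have hdeg : P.natDegree = 2 := by
    rw [← hlam]; exact (lam_eq_natDegree_weierstrassDistinguished (eq_C_pow_mu_mul_pfree g) hred).symm
  have ha : P.coeff 1 ∈ IsLocalRing.maximalIdeal ℤ_[p] := hW.isDistinguishedAt.mem (by rw [hdeg]; norm_num)
  have hb : P.coeff 0 ∈ IsLocalRing.maximalIdeal ℤ_[p] := hW.isDistinguishedAt.mem (by rw [hdeg]; norm_num)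
  have hPeq : (P : ℤ_[p]⟦X⟧) = X ^ 2 + C (P.coeff 1) * X + C (P.coeff 0) := by
    have h := hW.isDistinguishedAt.monic.as_sum
    rw [hdeg] at h
    conv_lhs => rw [h]
    simp only [Finset.sum_range_succ, Finset.sum_range_zero, zero_add, pow_zero, mul_one, pow_one,
      Polynomial.coe_add, Polynomial.coe_mul, Polynomial.coe_pow, Polynomial.coe_C, Polynomial.coe_X]
    ring
  have hfac : pfree g = (X ^ 2 + C (P.coeff 1) * X + C (P.coeff 0)) * U := by rw [← hPeq]; exact hW.eq_mul
  -- the symmetry descends from `g = p^μ · pfree g` to `pfree g`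
  obtain ⟨w, hw⟩ := Ideal.span_singleton_eq_span_singleton.mp hsym
  have hw' : (C ((p : ℤ_[p]) ^ mu g) * pfree g).subst (invOnePlusSubOne : ℤ_[p]⟦X⟧) * ↑w =
      C ((p : ℤ_[p]) ^ mu g) * pfree g := by
    rw [← eq_C_pow_mu_mul_pfree g]; exact hw
  rw [subst_mul hι, subst_invOnePlusSubOne_C_padicInt, mul_assoc] at hw'
  have hpf : (pfree g).subst (invOnePlusSubOne : ℤ_[p]⟦X⟧) * ↑w = pfree g :=
    mul_left_cancel₀ (C_pow_ne_zero (mu g)) hw'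
  have hFE : (pfree g).subst (invOnePlusSubOne : ℤ_[p]⟦X⟧) = ↑w⁻¹ * pfree g := by
    have h := congrArg (· * ((↑w⁻¹ : (ℤ_[p]⟦X⟧)ˣ) : ℤ_[p]⟦X⟧)) hpf
    simp only [Units.mul_inv_cancel_right] at h
    rw [mul_comm]; exact h
  rw [hfac] at hFE
  obtain ⟨h0, h1⟩ := quadratic_iota_law ha hb hW.isUnit (Units.isUnit w⁻¹) hFE
  refine ⟨P.coeff 1, P.coeff 0, U, hW.isUnit, ha, hb, hfac, ?_⟩
  rcases mul_eq_zero.mp h0 with hb0 | hba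
  · rw [hb0, sub_zero] at h1
    rcases mul_eq_zero.mp h1 with ha0 | ha2
    · exact Or.inl (ha0.trans hb0.symm)
    · exact Or.inr ⟨hb0, by linear_combination -ha2⟩
  · exact Or.inl (sub_eq_zero.mp hba).symm

/-- **Odd `p`: the distinguished polynomial of an `ι`-symmetric `g` with `λ(g) = 2` is always `T² + a(T+1)`**
(`a ∈ pℤ_p`): the second family `T(T+2)` of `exists_normalForm_of_lam_eq_two` needs `2 ∈ pℤ_p`.  Its two roots
`r, r^ι = −r/(1+r)` are exchanged by `ι`. [cite: Washington1997, Thm. 7.3] [cite: GreenbergLNM1716, §1 (p. 68)] -/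
theorem exists_normalForm_of_lam_eq_two_odd (hp : p ≠ 2) {g : IwasawaAlgebra p} (hg : g ≠ 0) (hlam : lam g = 2)
    (hsym : Ideal.span {g.subst (invOnePlusSubOne : ℤ_[p]⟦X⟧)} = Ideal.span {g}) :
    ∃ (a : ℤ_[p]) (U : ℤ_[p]⟦X⟧), IsUnit U ∧ a ∈ IsLocalRing.maximalIdeal ℤ_[p] ∧
      pfree g = (X ^ 2 + C a * (X + 1)) * U := by
  obtain ⟨a, b, U, hU, ha, hb, hfac, hab⟩ := exists_normalForm_of_lam_eq_two hg hlam hsym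
  rcases hab with rfl | ⟨-, rfl⟩
  · exact ⟨a, U, hU, ha, by rw [hfac]; ring⟩
  · exact absurd ha (two_not_mem_maximalIdeal hp)

/-! ## §4 Readings of the normal form -/

section Readings

variable {h U : ℤ_[p]⟦X⟧} {a b : ℤ_[p]}

/-- Constant term of the normal form: `h(0) = b·U(0)`. [folklore] -/
theorem constantCoeff_normalForm (hfac : h = (X ^ 2 + C a * X + C b) * U) :
    constantCoeff h = b * constantCoeff U := by
  rw [hfac]; simp

/-- `T ∣ h ⟺ b = 0` for `h = (T² + aT + b)·U`, `U ∈ Λˣ`. [folklore] -/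
theorem X_dvd_normalForm_iff (hfac : h = (X ^ 2 + C a * X + C b) * U) (hU : IsUnit U) :
    (X : ℤ_[p]⟦X⟧) ∣ h ↔ b = 0 := by
  rw [X_dvd_iff, constantCoeff_normalForm hfac, mul_eq_zero, or_iff_left]
  exact (isUnit_iff_constantCoeff.mp hU).ne_zero

/-- `p^k ∣ h(0) ⟺ p^k ∣ b` for `h = (T² + aT + b)·U`, `U ∈ Λˣ`. [folklore] -/
theorem pow_dvd_constantCoeff_normalForm_iff (hfac : h = (X ^ 2 + C a * X + C b) * U) (hU : IsUnit U) (k : ℕ) :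
    (p : ℤ_[p]) ^ k ∣ constantCoeff h ↔ (p : ℤ_[p]) ^ k ∣ b := by
  rw [constantCoeff_normalForm hfac]
  exact IsUnit.dvd_mul_right (isUnit_iff_constantCoeff.mp hU)

/-- The pair-sum law of the first family: `P(0) + P(−2) = 4` for `P = T² + a(T+1)` — at `p = 2` the two fixed points
`T = 0` (trivial character) and `T = −2` (the quadratic character of `Γ`) of `ι`. [folklore] -/
theorem eval_zero_add_eval_neg_two (a : ℤ_[p]) :
    (Polynomial.X ^ 2 + Polynomial.C a * (Polynomial.X + 1) : Polynomial ℤ_[p]).eval 0 +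
      (Polynomial.X ^ 2 + Polynomial.C a * (Polynomial.X + 1) : Polynomial ℤ_[p]).eval (-2) = 4 := by
  simp; ring

/-- `red` and `μ` of a distinguished polynomial: `f ≢ 0 (mod p)` and `μ(f) = 0`. [cite: Washington1997, §7.1] -/
theorem red_coe_ne_zero_and_mu_coe {f : Polynomial ℤ_[p]} (hf : f.IsDistinguishedAt (IsLocalRing.maximalIdeal ℤ_[p])) :
    red (f : IwasawaAlgebra p) ≠ 0 ∧ mu (f : IwasawaAlgebra p) = 0 := by
  have hred : red (f : IwasawaAlgebra p) ≠ 0 := by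
    intro h0
    have e := congr_arg (coeff f.natDegree) h0
    rw [coeff_map, Polynomial.coeff_coe, hf.monic.coeff_natDegree, map_one, map_zero] at e
    exact one_ne_zero e
  have hfac : (f : IwasawaAlgebra p) = C ((p : ℤ_[p]) ^ 0) * (f : IwasawaAlgebra p) := by
    rw [pow_zero, map_one, one_mul]
  exact ⟨hred, (mu_eq_and_pfree_eq hred hfac).1⟩

/-- **Rigidity of the normal form.**  If a distinguished quadratic `T² + a'T + b'` (`a', b' ∈ pℤ_p`) divides
`h = (T² + aT + b)·U` (`a, b ∈ pℤ_p`, `U ∈ Λˣ`), then `a' = a` and `b' = b`: the cofactor is a unit by `μ/λ`-additivity and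
Weierstrass preparation is unique. [cite: Washington1997, Thm. 7.3] -/
theorem eq_of_quadratic_dvd_normalForm {a' b' : ℤ_[p]} (ha : a ∈ IsLocalRing.maximalIdeal ℤ_[p])
    (hb : b ∈ IsLocalRing.maximalIdeal ℤ_[p]) (ha' : a' ∈ IsLocalRing.maximalIdeal ℤ_[p])
    (hb' : b' ∈ IsLocalRing.maximalIdeal ℤ_[p]) (hfac : h = (X ^ 2 + C a * X + C b) * U) (hU : IsUnit U)
    (hdvd : (X ^ 2 + C a' * X + C b' : ℤ_[p]⟦X⟧) ∣ h) : a' = a ∧ b' = b := by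
  set P : Polynomial ℤ_[p] := Polynomial.C 1 * Polynomial.X ^ 2 + Polynomial.C a * Polynomial.X + Polynomial.C b
    with hP
  set Q : Polynomial ℤ_[p] := Polynomial.C 1 * Polynomial.X ^ 2 + Polynomial.C a' * Polynomial.X + Polynomial.C b'
    with hQ
  have hPd : P.IsDistinguishedAt (IsLocalRing.maximalIdeal ℤ_[p]) := (isDistinguishedAt_quadratic ha hb).1
  have hQd : Q.IsDistinguishedAt (IsLocalRing.maximalIdeal ℤ_[p]) := (isDistinguishedAt_quadratic ha' hb').1
  obtain ⟨r, hr⟩ := hdvd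
  obtain ⟨Uu, rfl⟩ := hU
  -- `P = Q · s` with `s = r · U⁻¹`
  have hPs : (P : ℤ_[p]⟦X⟧) = (Q : ℤ_[p]⟦X⟧) * (r * ↑Uu⁻¹) := by
    rw [coe_quadratic, coe_quadratic, ← mul_assoc, ← hr, hfac, Units.mul_inv_cancel_right]
  have hP0 : (P : ℤ_[p]⟦X⟧) ≠ 0 := coe_ne_zero_of_isDistinguishedAt hPd
  have hQ0 : (Q : ℤ_[p]⟦X⟧) ≠ 0 := coe_ne_zero_of_isDistinguishedAt hQd
  have hs0 : r * (↑Uu⁻¹ : ℤ_[p]⟦X⟧) ≠ 0 := fun h0 ↦ hP0 (by rw [hPs, h0, mul_zero])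
  have hs : IsUnit (r * (↑Uu⁻¹ : ℤ_[p]⟦X⟧)) := by
    rw [isUnit_iff_mu_eq_zero_and_lam_eq_zero]
    have hμ := (red_coe_ne_zero_and_mu_coe hPd).2
    have hlamP := lam_coe_eq_natDegree hPd
    rw [hPs, mu_mul hQ0 hs0, (red_coe_ne_zero_and_mu_coe hQd).2] at hμ
    rw [hPs, lam_mul hQ0 hs0, lam_coe_eq_natDegree hQd, hP, hQ, Polynomial.natDegree_quadratic one_ne_zero,
      Polynomial.natDegree_quadratic one_ne_zero] at hlamP
    exact ⟨hs0, by omega, by omega⟩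
  have hW1 : (P : ℤ_[p]⟦X⟧).IsWeierstrassFactorization P 1 := ⟨hPd, isUnit_one, (mul_one _).symm⟩
  have hW2 : (P : ℤ_[p]⟦X⟧).IsWeierstrassFactorization Q (r * ↑Uu⁻¹) := ⟨hQd, hs, hPs⟩
  have hPQ : P = Q := (hW1.elim hW2).1
  have h0 := congrArg (Polynomial.coeff · 0) hPQ
  have h1 := congrArg (Polynomial.coeff · 1) hPQ
  simp only [hP, hQ] at h0 h1
  simp at h0 h1
  exact ⟨h1.symm, h0.symm⟩

end Readings

/-! ## §5 Elliptic curves: integral lifts of a good-ordinary `L_p(E,T)` with `λ = 2` -/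

section Elliptic

open scoped MatrixGroups ModularForm

open CongruenceSubgroup WeierstrassCurve

variable {W : WeierstrassCurve ℚ} [W.IsElliptic] [W.IsGloballyMinimal] {N : ℕ} [NeZero N]
  {f : CuspForm (Gamma0 N) 2}

/-- ★ **`λ = 2` normal form for a good-ordinary `L_p(E,T)` (any prime `p`).**  If `b ∈ Λ ∖ {0}` is an integral lift of a
scalar multiple of `L_p(E,T)` (`ι_Λ b = t·L_p(f, α_p)`, `E` good ordinary at `p`, `f` its newform) with `λ(b) = 2`, then
`pfree b = (T² + aT + c)·U`, `U ∈ Λˣ`, `a, c ∈ pℤ_p`, and `a = c` or `(c = 0 ∧ a = 2)`.  The symmetry input is the MTT functional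
equation descended to `Λ` (`IwasawaAlgebra.span_singleton_subst_eq_of_eq_padicLFunction`).
[cite: MazurTateTeitelbaum1986Invent, §I.17] [cite: GreenbergLNM1716, §1 (p. 68)] [cite: Washington1997, Thm. 7.3] -/
theorem normalForm_of_eq_padicLFunction (hord : IsOrdinaryAt W p) (hf : IsNewformOf W f)
    {b : IwasawaAlgebra p} {t : ℚ_[p]}
    (hb : iwasawaToPowerSeries p b = PowerSeries.C t * padicLFunction f (unitRoot W p : ℚ_[p]))
    (hb0 : b ≠ 0) (hlam : lam b = 2) :
    ∃ (a c : ℤ_[p]) (U : ℤ_[p]⟦X⟧), IsUnit U ∧ a ∈ IsLocalRing.maximalIdeal ℤ_[p] ∧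
      c ∈ IsLocalRing.maximalIdeal ℤ_[p] ∧ pfree b = (X ^ 2 + C a * X + C c) * U ∧ (a = c ∨ (c = 0 ∧ a = 2)) :=
  exists_normalForm_of_lam_eq_two hb0 hlam (IwasawaAlgebra.span_singleton_subst_eq_of_eq_padicLFunction hord hf hb)

/-- ★ **Odd `p`: the two zeros of a `λ = 2` good-ordinary `L_p(E,T)` are `ι`-conjugate** — the distinguished polynomial is
`T² + a(T+1)`, `a ∈ pℤ_p` (`a = 0`: the double zero at `T = 0` of analytic rank `≥ 2`; `a ≠ 0`: a pair `r, r^ι = −r/(1+r)`).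
[cite: MazurTateTeitelbaum1986Invent, §I.17] [cite: GreenbergLNM1716, §1 (p. 68)] [cite: Washington1997, Thm. 7.3] -/
theorem normalForm_of_eq_padicLFunction_odd (hp : p ≠ 2) (hord : IsOrdinaryAt W p) (hf : IsNewformOf W f)
    {b : IwasawaAlgebra p} {t : ℚ_[p]}
    (hb : iwasawaToPowerSeries p b = PowerSeries.C t * padicLFunction f (unitRoot W p : ℚ_[p]))
    (hb0 : b ≠ 0) (hlam : lam b = 2) :
    ∃ (a : ℤ_[p]) (U : ℤ_[p]⟦X⟧), IsUnit U ∧ a ∈ IsLocalRing.maximalIdeal ℤ_[p] ∧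
      pfree b = (X ^ 2 + C a * (X + 1)) * U :=
  exists_normalForm_of_lam_eq_two_odd hp hb0 hlam
    (IwasawaAlgebra.span_singleton_subst_eq_of_eq_padicLFunction hord hf hb)

end Elliptic

end Summit.BirchSwinnertonDyer.BirchSwinnertonDyer.Theorems.LambdaTransportDoorIotaSymmetryLambdaTwo

end
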